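import Mathlib
import Summits.Ventures.PercRepro2.A3CutFMoFibres

/-!
# The fibre terms of `v` and of `x` when the mark `o` lies on the part's side
(blind cell PercRepro2, night-1 g32; proofs/NIGHT1-G32.md §6; the closure is A3CutFMo.lean)

Pointwise forms of the six fibre terms of `FMfun` (A3CutFMoFibres): at a fibre containing `x` they are
the `Z`-restricted `x`-terms with `F⁰ = σ₃ γ₀` (`term_v_oA`, `SFg_v_oA`, the `A`-terms vanish), at a fibre
avoiding `x` they are the `A`-side mass `P_A(C_A(v) = W, o ↔ x)` times the unconditioned `B`-side
masses (`termA_v_oA`, `SuA_o_v_oA`); on the `x`-side the `o`-terms collapse (`term_x_oA`, `SuA_o_x_oA`).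
`sum_aZo_notMem`: the `A`-side masses over the sets avoiding `x` sum to `P_A(v ↮ x, o ↔ x)`
(`sum_prob_sideA_clusterV_inter`: the `A`-side clusters of `v` partition every `A`-side event).
Standard axioms.
-/

namespace Summit.Ventures.PercRepro2

open UnionCluster CovForm CutV

namespace CovForm

namespace A3Fibre

/-! ## The fibre sums of `v` with `o` on the `A`-side, and the closure -/

section OSideMain

variable {V : Type*} {E : Type*} [Fintype V] [DecidableEq V] [Fintype E] [DecidableEq E]
  {R : Type*} [Field R] [LinearOrder R] [IsStrictOrderedRing R] {ends : E → Sym2 V} {x : V}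
  {VA VB : Finset V} {EA EB : Set E} [DecidablePred (· ∈ EA)] [DecidablePred (· ∈ EB)] {p : E → R}
  {o a₁ a₂ b v : V}

omit [LinearOrder R] [IsStrictOrderedRing R] [DecidablePred (· ∈ EB)] in
/-- The `A`-side clusters of `v` partition every `A`-side event. -/
lemma sum_prob_sideA_clusterV_inter (p : E → R) (v : V) (Y : Set (Config E)) :
    ∑ W : Finset V, prob p (sideEvent EA (clusterEvent ends v (↑W : Set V) ∩ Y)) =
      prob p (sideEvent EA Y) := by
  unfold prob
  rw [Finset.sum_comm]
  refine Finset.sum_congr rfl fun ω _ => ?_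
  by_cases hZ : ω ∈ sideEvent EA Y
  · have key' : ∀ W : Finset V,
        (sideEvent EA (clusterEvent ends v (↑W : Set V) ∩ Y)).indicator (weight p) ω =
          (clusterEvent ends v (↑W : Set V)).indicator (fun _ => weight p ω) (restrict EA ω) := by
      intro W
      by_cases hW : restrict EA ω ∈ clusterEvent ends v (↑W : Set V)
      · rw [Set.indicator_of_mem hW, Set.indicator_of_mem]
        exact ⟨hW, hZ⟩
      · rw [Set.indicator_of_notMem hW, Set.indicator_of_notMem]
        intro hc; exact hW hc.1
    simp_rw [key']
    rw [sum_indicator_clusterEvent, Set.indicator_of_mem hZ]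
  · rw [Set.indicator_of_notMem hZ]
    refine Finset.sum_eq_zero fun W _ => ?_
    rw [Set.indicator_of_notMem]
    intro hc; exact hZ hc.2

omit [LinearOrder R] [IsStrictOrderedRing R] [DecidablePred (· ∈ EB)] in
/-- The `A`-side masses `P_A(C_A(v) = W, o ↔ x)` over the sets avoiding `x` sum to
`P_A(v ↮ x, o ↔ x)`. -/
lemma sum_aZo_notMem :
    ∑ W : Finset V, (if x ∈ W then 0 else
        prob p (sideEvent EA (clusterEvent ends v (↑W : Set V) ∩ connEvent ends o x))) =
      prob p (sideEvent EA ((connEvent ends v x)ᶜ ∩ connEvent ends o x)) := by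
  have key : ∀ W : Finset V,
      (if x ∈ W then 0 else prob p (sideEvent EA (clusterEvent ends v (↑W : Set V) ∩ connEvent ends o x))) =
        prob p (sideEvent EA (clusterEvent ends v (↑W : Set V) ∩
          ((connEvent ends v x)ᶜ ∩ connEvent ends o x))) := by
    intro W
    split_ifs with hxW
    · symm
      have : sideEvent EA (clusterEvent ends v (↑W : Set V) ∩ ((connEvent ends v x)ᶜ ∩ connEvent ends o x)) = ∅ := by
        ext ω
        simp only [mem_sideEvent, Set.mem_inter_iff, mem_clusterEvent, Set.mem_compl_iff,
          mem_connEvent, Set.mem_empty_iff_false, iff_false, not_and]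
        intro hc hvx
        exfalso
        apply hvx
        show x ∈ cluster ends (restrict EA ω) v
        rw [hc]
        exact Finset.mem_coe.2 hxW
      rw [this, prob_empty]
    · congr 1
      ext ω
      simp only [mem_sideEvent, Set.mem_inter_iff, mem_clusterEvent, Set.mem_compl_iff, mem_connEvent]
      constructor
      · rintro ⟨hc, hox⟩
        refine ⟨hc, fun hvx => hxW ?_, hox⟩
        have : x ∈ cluster ends (restrict EA ω) v := hvx
        rw [hc] at this
        exact Finset.mem_coe.1 this
      · rintro ⟨hc, _, hox⟩
        exact ⟨hc, hox⟩
  simp_rw [key]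
  exact sum_prob_sideA_clusterV_inter (EA := EA) p v _

omit [Fintype V] [DecidableEq V] [DecidablePred (· ∈ EB)] in
/-- `P_A(C_A(v) = W, o ↔ x) ≤ P_A(C_A(v) = W)`. -/
lemma aZo_le_aV (hp : IsProbVec p) (v : V) (W : Finset V) :
    prob p (sideEvent EA (clusterEvent ends v (↑W : Set V) ∩ connEvent ends o x)) ≤
      prob p (sideEvent EA (clusterEvent ends v (↑W : Set V))) :=
  prob_mono hp fun _ hω => hω.1

omit [Fintype V] [DecidableEq V] in
/-- The `Z`-restricted `σ_y`-mass vanishes with the `Z`-restricted fibre mass. -/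
lemma SsigZ_eq_zero_of_mZ_eq_zero (hp : IsProbVec p) (a₁ a₂ y : V) (Z : Set (Config E))
    (W : Finset V) (hm : mZ p ends a₁ a₂ x Z W = 0) : SsigZ p ends a₁ a₂ x y Z W = 0 := by
  unfold mZ at hm
  unfold SsigZ
  have h1 : prob p (fibre ends a₁ a₂ x W ∩ Z ∩ connEvent ends a₁ y) = 0 :=
    le_antisymm (hm ▸ prob_mono hp Set.inter_subset_left) (prob_nonneg hp _)
  have h2 : prob p (fibre ends a₁ a₂ x W ∩ Z ∩ connEvent ends a₂ y) = 0 :=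
    le_antisymm (hm ▸ prob_mono hp Set.inter_subset_left) (prob_nonneg hp _)
  rw [h1, h2, sub_zero]

omit [Fintype V] [DecidableEq V] in
/-- The `Z`-restricted `U_y`-mass vanishes with the `Z`-restricted fibre mass. -/
lemma SuZ_eq_zero_of_mZ_eq_zero (hp : IsProbVec p) (a₁ a₂ y : V) (Z : Set (Config E))
    (W : Finset V) (hm : mZ p ends a₁ a₂ x Z W = 0) : SuZ p ends a₁ a₂ x y Z W = 0 := by
  unfold mZ at hm
  unfold SuZ
  have h1 : prob p (fibre ends a₁ a₂ x W ∩ Z ∩ connEvent ends a₁ y) = 0 :=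
    le_antisymm (hm ▸ prob_mono hp Set.inter_subset_left) (prob_nonneg hp _)
  have h2 : prob p (fibre ends a₁ a₂ x W ∩ Z ∩ connEvent ends a₂ y) = 0 :=
    le_antisymm (hm ▸ prob_mono hp Set.inter_subset_left) (prob_nonneg hp _)
  rw [h1, h2, add_zero]

omit [Fintype V] in
/-- The ratio term of `v` at a fibre, `o` on the `A`-side. -/
lemma term_v_oA (hp : IsProbVec p) (h : IsCut ends x ↑VA ↑VB EA EB) (ho : o ∈ VA) (hv : v ∈ VA)
    (h1 : a₁ ∈ insert x VB) (h2 : a₂ ∈ insert x VB) (hb : b ∈ insert x VB) (γ : R) (W : Finset V) :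
    Ssig p ends a₁ a₂ v b W * RootEdge.SFg p ends o a₁ a₂ v γ W / mW p ends a₁ a₂ v W =
      (if x ∈ W then s3 a₁ a₂ W * γ * SsigZ p ends a₁ a₂ x b (connEvent ends v x) W else
        (prob p (avoidAll ends a₂ {a₁} ∩ connEvent ends a₁ b) -
            prob p (avoidAll ends a₂ {a₁} ∩ connEvent ends a₂ b)) *
          (prob p (avoidAll ends a₂ {a₁} ∩ connEvent ends x a₁) -
            prob p (avoidAll ends a₂ {a₁} ∩ connEvent ends x a₂)) *
          prob p (sideEvent EA (clusterEvent ends v (↑W : Set V) ∩ connEvent ends o x)) /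
          prob p (avoidAll ends a₂ {a₁})) := by
  unfold RootEdge.SFg
  rw [mW_v_eq h hv h1 h2, Ssig_v_eq h hv h1 h2 hb, Ssig_o_v_eq h ho hv h1 h2, Su_o_v_eq h ho hv h1 h2,
    SsigZ_o_eq h ho h1 h2, SuZ_o_eq h ho h1 h2]
  by_cases hxW : x ∈ W
  · simp only [hxW, if_true, add_zero]
    by_cases hm : mZ p ends a₁ a₂ x (connEvent ends v x) W = 0
    · simp [hm, SsigZ_eq_zero_of_mZ_eq_zero hp a₁ a₂ b _ W hm]
    · have e : (if o ∈ W then (1 : R) else 0) * (s3 a₁ a₂ W * mZ p ends a₁ a₂ x (connEvent ends v x) W) +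
          s3 a₁ a₂ W * (γ * mZ p ends a₁ a₂ x (connEvent ends v x) W -
            (if o ∈ W then (1 : R) else 0) * (s3 a₁ a₂ W ^ 2 * mZ p ends a₁ a₂ x (connEvent ends v x) W)) =
          s3 a₁ a₂ W * γ * mZ p ends a₁ a₂ x (connEvent ends v x) W := by
        unfold s3
        split_ifs <;> ring
      rw [e]
      field_simp
  · simp only [hxW, if_false]
    have he := clusterEvent_x_eq_empty_of_notMem (ends := ends) hxW
    rw [mZ_eq_zero_of_empty _ he, SsigZ_eq_zero_of_empty _ he]
    simp only [mul_zero, zero_add]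
    by_cases hWA : W ⊆ VA
    · have hs3 : (s3 a₁ a₂ W : R) = 0 :=
        s3_eq_zero_of_notMem (fun hc => notMem_VA_of_mem_VB h h1 (hWA hc))
          (fun hc => notMem_VA_of_mem_VB h h2 (hWA hc))
      rw [hs3]
      simp only [zero_mul, add_zero]
      by_cases haV : prob p (sideEvent EA (clusterEvent ends v (↑W : Set V))) = 0
      · have haZ : prob p (sideEvent EA (clusterEvent ends v (↑W : Set V) ∩ connEvent ends o x)) = 0 :=
          le_antisymm (haV ▸ aZo_le_aV hp v W) (prob_nonneg hp _)
        simp [haV, haZ]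
      · field_simp
    · have haV := aV_eq_zero_of_not_subset (p := p) h hv hxW hWA
      have haZ : prob p (sideEvent EA (clusterEvent ends v (↑W : Set V) ∩ connEvent ends o x)) = 0 :=
        le_antisymm (haV ▸ aZo_le_aV hp v W) (prob_nonneg hp _)
      simp [haV, haZ]

omit [Fintype V] in
/-- The first-order form of `v` at a fibre, `o` on the `A`-side. -/
lemma SFg_v_oA (hp : IsProbVec p) (h : IsCut ends x ↑VA ↑VB EA EB) (ho : o ∈ VA) (hv : v ∈ VA)
    (h1 : a₁ ∈ insert x VB) (h2 : a₂ ∈ insert x VB) (γ : R) (W : Finset V) :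
    RootEdge.SFg p ends o a₁ a₂ v γ W =
      (if x ∈ W then s3 a₁ a₂ W * γ * mZ p ends a₁ a₂ x (connEvent ends v x) W else
        prob p (sideEvent EA (clusterEvent ends v (↑W : Set V) ∩ connEvent ends o x)) *
          (prob p (avoidAll ends a₂ {a₁} ∩ connEvent ends x a₁) -
            prob p (avoidAll ends a₂ {a₁} ∩ connEvent ends x a₂))) := by
  unfold RootEdge.SFg
  rw [mW_v_eq h hv h1 h2, Ssig_o_v_eq h ho hv h1 h2, Su_o_v_eq h ho hv h1 h2, SsigZ_o_eq h ho h1 h2,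
    SuZ_o_eq h ho h1 h2]
  by_cases hxW : x ∈ W
  · simp only [hxW, if_true, add_zero]
    unfold s3
    split_ifs <;> ring
  · simp only [hxW, if_false]
    have he := clusterEvent_x_eq_empty_of_notMem (ends := ends) hxW
    rw [mZ_eq_zero_of_empty (p := p) _ he]
    simp only [mul_zero, zero_add]
    by_cases hWA : W ⊆ VA
    · have hs3 : (s3 a₁ a₂ W : R) = 0 :=
        s3_eq_zero_of_notMem (fun hc => notMem_VA_of_mem_VB h h1 (hWA hc))
          (fun hc => notMem_VA_of_mem_VB h h2 (hWA hc))
      rw [hs3]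
      ring
    · have haV := aV_eq_zero_of_not_subset (p := p) h hv hxW hWA
      have haZ : prob p (sideEvent EA (clusterEvent ends v (↑W : Set V) ∩ connEvent ends o x)) = 0 :=
        le_antisymm (haV ▸ aZo_le_aV hp v W) (prob_nonneg hp _)
      rw [haV, haZ]
      ring

omit [Fintype V] in
/-- The `A`-ratio term of `v` at a fibre, `o` on the `A`-side. -/
lemma termA_v_oA (hp : IsProbVec p) (h : IsCut ends x ↑VA ↑VB EA EB) (ho : o ∈ VA) (hv : v ∈ VA)
    (h1 : a₁ ∈ insert x VB) (h2 : a₂ ∈ insert x VB) (hb : b ∈ insert x VB) (W : Finset V) :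
    (if a₁ ∉ W ∧ a₂ ∉ W then Su p ends a₁ a₂ v b W * Su p ends a₁ a₂ v o W / mW p ends a₁ a₂ v W
      else 0) =
      (if x ∈ W then 0 else
        (prob p (avoidAll ends a₂ {a₁} ∩ connEvent ends a₁ b) +
            prob p (avoidAll ends a₂ {a₁} ∩ connEvent ends a₂ b)) *
          (prob p (avoidAll ends a₂ {a₁} ∩ connEvent ends x a₁) +
            prob p (avoidAll ends a₂ {a₁} ∩ connEvent ends x a₂)) *
          prob p (sideEvent EA (clusterEvent ends v (↑W : Set V) ∩ connEvent ends o x)) /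
          prob p (avoidAll ends a₂ {a₁})) := by
  rw [mW_v_eq h hv h1 h2, Su_v_eq h hv h1 h2 hb, Su_o_v_eq h ho hv h1 h2, SuZ_o_eq h ho h1 h2]
  by_cases hxW : x ∈ W
  · simp only [hxW, if_true, add_zero]
    by_cases hA : a₁ ∉ W ∧ a₂ ∉ W
    · rw [if_pos hA, s3_eq_zero_of_notMem hA.1 hA.2]
      simp
    · rw [if_neg hA]
  · simp only [hxW, if_false]
    have he := clusterEvent_x_eq_empty_of_notMem (ends := ends) hxW
    rw [mZ_eq_zero_of_empty (p := p) _ he, SuZ_eq_zero_of_empty (p := p) _ he]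
    simp only [mul_zero, zero_add]
    by_cases hWA : W ⊆ VA
    · have hA : a₁ ∉ W ∧ a₂ ∉ W := ⟨fun hc => notMem_VA_of_mem_VB h h1 (hWA hc),
        fun hc => notMem_VA_of_mem_VB h h2 (hWA hc)⟩
      rw [if_pos hA]
      by_cases haV : prob p (sideEvent EA (clusterEvent ends v (↑W : Set V))) = 0
      · have haZ : prob p (sideEvent EA (clusterEvent ends v (↑W : Set V) ∩ connEvent ends o x)) = 0 :=
          le_antisymm (haV ▸ aZo_le_aV hp v W) (prob_nonneg hp _)
        simp [haV, haZ]
      · rw [show prob p (sideEvent EA (clusterEvent ends v (↑W : Set V))) *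
            (prob p (avoidAll ends a₂ {a₁} ∩ connEvent ends a₁ b) +
              prob p (avoidAll ends a₂ {a₁} ∩ connEvent ends a₂ b)) *
            (prob p (sideEvent EA (clusterEvent ends v (↑W : Set V) ∩ connEvent ends o x)) *
              (prob p (avoidAll ends a₂ {a₁} ∩ connEvent ends x a₁) +
                prob p (avoidAll ends a₂ {a₁} ∩ connEvent ends x a₂))) =
            prob p (sideEvent EA (clusterEvent ends v (↑W : Set V))) *
            ((prob p (avoidAll ends a₂ {a₁} ∩ connEvent ends a₁ b) +
              prob p (avoidAll ends a₂ {a₁} ∩ connEvent ends a₂ b)) *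
            (prob p (avoidAll ends a₂ {a₁} ∩ connEvent ends x a₁) +
                prob p (avoidAll ends a₂ {a₁} ∩ connEvent ends x a₂)) *
            prob p (sideEvent EA (clusterEvent ends v (↑W : Set V) ∩ connEvent ends o x))) by ring,
          mul_div_mul_left _ _ haV]
    · have haV := aV_eq_zero_of_not_subset (p := p) h hv hxW hWA
      have haZ : prob p (sideEvent EA (clusterEvent ends v (↑W : Set V) ∩ connEvent ends o x)) = 0 :=
        le_antisymm (haV ▸ aZo_le_aV hp v W) (prob_nonneg hp _)
      rw [haV, haZ]
      simp

omit [Fintype V] in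
/-- The `A`-part `U_o`-mass of `v` at a fibre, `o` on the `A`-side. -/
lemma SuA_o_v_oA (hp : IsProbVec p) (h : IsCut ends x ↑VA ↑VB EA EB) (ho : o ∈ VA) (hv : v ∈ VA)
    (h1 : a₁ ∈ insert x VB) (h2 : a₂ ∈ insert x VB) (W : Finset V) :
    (if a₁ ∉ W ∧ a₂ ∉ W then Su p ends a₁ a₂ v o W else 0) =
      (if x ∈ W then 0 else
        prob p (sideEvent EA (clusterEvent ends v (↑W : Set V) ∩ connEvent ends o x)) *
          (prob p (avoidAll ends a₂ {a₁} ∩ connEvent ends x a₁) +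
            prob p (avoidAll ends a₂ {a₁} ∩ connEvent ends x a₂))) := by
  rw [Su_o_v_eq h ho hv h1 h2, SuZ_o_eq h ho h1 h2]
  by_cases hxW : x ∈ W
  · simp only [hxW, if_true, add_zero]
    by_cases hA : a₁ ∉ W ∧ a₂ ∉ W
    · rw [if_pos hA, s3_eq_zero_of_notMem hA.1 hA.2]
      simp
    · rw [if_neg hA]
  · simp only [hxW, if_false]
    have he := clusterEvent_x_eq_empty_of_notMem (ends := ends) hxW
    rw [mZ_eq_zero_of_empty (p := p) _ he]
    simp only [mul_zero, zero_add]
    by_cases hWA : W ⊆ VA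
    · have hA : a₁ ∉ W ∧ a₂ ∉ W := ⟨fun hc => notMem_VA_of_mem_VB h h1 (hWA hc),
        fun hc => notMem_VA_of_mem_VB h h2 (hWA hc)⟩
      rw [if_pos hA]
    · have haV := aV_eq_zero_of_not_subset (p := p) h hv hxW hWA
      have haZ : prob p (sideEvent EA (clusterEvent ends v (↑W : Set V) ∩ connEvent ends o x)) = 0 :=
        le_antisymm (haV ▸ aZo_le_aV hp v W) (prob_nonneg hp _)
      rw [haZ]
      simp

omit [Fintype V] [DecidablePred (· ∈ EB)] in
/-- The ratio term of `x` at a fibre, `o` on the `A`-side. -/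
lemma term_x_oA (hp : IsProbVec p) (h : IsCut ends x ↑VA ↑VB EA EB) (ho : o ∈ VA)
    (h1 : a₁ ∈ insert x VB) (h2 : a₂ ∈ insert x VB) (γ : R) (W : Finset V) :
    Ssig p ends a₁ a₂ x b W * RootEdge.SFg p ends o a₁ a₂ x γ W / mW p ends a₁ a₂ x W =
      s3 a₁ a₂ W * γ * Ssig p ends a₁ a₂ x b W := by
  rw [SFg0_x_eq h ho h1 h2]
  by_cases hm : mW p ends a₁ a₂ x W = 0
  · simp [hm, Ssig_eq_zero_of_mW_eq_zero hp ends a₁ a₂ x b W hm]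
  · field_simp

omit [Fintype V] [LinearOrder R] [IsStrictOrderedRing R] [DecidablePred (· ∈ EB)] in
/-- The `A`-part `U_o`-mass of `x` vanishes, `o` on the `A`-side. -/
lemma SuA_o_x_oA (h : IsCut ends x ↑VA ↑VB EA EB) (ho : o ∈ VA) (h1 : a₁ ∈ insert x VB)
    (h2 : a₂ ∈ insert x VB) (W : Finset V) :
    (if a₁ ∉ W ∧ a₂ ∉ W then Su p ends a₁ a₂ x o W else 0) = 0 := by
  split_ifs with hA
  · rw [Su_o_x_eq h ho h1 h2, s3_eq_zero_of_notMem hA.1 hA.2]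
    ring
  · rfl

omit [Fintype E] [DecidableEq E] [Field R] [LinearOrder R] [IsStrictOrderedRing R]
  [DecidablePred (· ∈ EA)] [DecidablePred (· ∈ EB)] in
/-- Splitting a sum over the membership of `x`. -/
lemma sum_ite_mem_split {R : Type*} [AddCommMonoid R] (f g : Finset V → R) :
    ∑ W : Finset V, (if x ∈ W then f W else g W) =
      ∑ W : Finset V, (if x ∈ W then f W else 0) + ∑ W : Finset V, (if x ∈ W then 0 else g W) := by
  rw [← Finset.sum_add_distrib]
  refine Finset.sum_congr rfl fun W _ => ?_
  split_ifs <;> simp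

end OSideMain

end A3Fibre

end CovForm

end Summit.Ventures.PercRepro2
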